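import Literature.Analysis.OperatorTheory.YangMillsMatrixModelGroundStateComparison
import Literature.Analysis.OperatorTheory.YangMillsMatrixModelComparisonCalculus
import Literature.Analysis.OperatorTheory.YangMillsMatrixModelAgmonWeights
import HarnessLib

/-!
# A pointwise lower bound for the ground state of Lüscher's matrix-model Hamiltonian (cubic Agmon rate)

Topic `Literature/Analysis/OperatorTheory`.  For the Schrödinger operator `𝔥 = −½Δ + V` on `ℝ⁹ = (ℝ³)³`,
`V(x) = ¼ Σ_{i,j} |x_i × x_j|²` (`luscherPotential`), every POSITIVE classical solution `f` of `𝔥f = Ef`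
(in particular the ground state `f_0`, `YangMillsMatrixModelGroundStatePositivity.lean`) obeys the
Carmona–Simon lower bound

  `f(y) ≥ c · exp(−a (1 + ‖y‖)³)`   for all `y ∈ ℝ⁹`, for EVERY `a > 1/√18` and some `c = c(a, f) > 0`

(Carmona–Simon 1981, Thm. for potentials `V ≤ C(1+|x|)^{2m}`: `ψ₀(x) ≥ c e^{−a|x|^{m+1}}`, here `m = 2`;
Davies–Simon 1984, (6.4)).  The printed proofs are path-integral (Feynman–Kac); the proof here is the
elementary COMPARISON argument: `W_a(x) = exp(−a⟨x⟩³)`, `⟨x⟩ = √(1+‖x‖²)`, is a strict subsolution of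
`𝔥 − E` outside a ball as soon as `(9/2)a² > ¼` — because `ΔW_a/W_a = 9a²⟨x⟩²‖x‖² − 3a(‖x‖²/⟨x⟩ + 9⟨x⟩)`
(§2) and `V ≤ ¼‖x‖⁴` (Lagrange's identity, `luscherPotential_le_norm_pow_four`) — and the generalised maximum principle with the positive
solution `f` itself (`le_of_strict_subsolution`, `YangMillsMatrixModelGroundStateComparison.lean`) compares
`m(W_a − W_a(T))` with `f` on the annuli `t₀ ≤ ⟨x⟩ ≤ T`, `T → ∞` (§4).  The threshold `1/√18` is the
generic-direction Agmon rate `∫ √(2·¼r⁴) dr = r³/(3√2)`.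

Contents (all proved; no definitions, no named facts):
* §1 inputs (`V(x) ≤ ¼‖x‖⁴` and coordinate calculus from `YangMillsMatrixModelComparisonCalculus.lean`);
* §2 the cubic bracket profile `h_a = −a⟨x⟩³` and weight `W_a = e^{h_a}`:
  `pderiv_cubicProfile`, `pderiv_pderiv_cubicProfile`, `laplacian_cubicProfile`, `pderiv_cubicWeight`,
  `laplacian_cubicWeight`, `hApply_cubicWeight`;
* §3 `hApply_cubicWeight_neg`: for `a > 0`, `18a² > 1`: `𝔥W_a + (|E| − E + 1)W_a ≤ 0` on `⟨x⟩ ≥ t₀(a,E)`;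
  `hApply_const_mul_sub_const` (`𝔥(m(W − κ)) = m(𝔥W − Vκ)`);
* §4 ★★ `groundState_lower_bound_cubic` (explicit rate `a`), ★ `groundState_lower_bound_cubic'` (`∃ c a`).

Companion file (pen infvol-p2, LEAD 20205 arbitration 2026-08-27): `YangMillsMatrixModelGroundStateLowerBound.lean`
carries the quartic-rate form `∀ a > 0, f ≥ c_a e^{−a‖y‖⁴}` consumed by the femto crux; it follows from the
cubic form here (any `a`), and conversely needs only a polynomial exponent.

## References
* [CarmonaSimon1981] R. Carmona, B. Simon, *Pointwise bounds on eigenfunctions and wave packets in N-body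
  quantum systems V: lower bounds and path integrals*, Comm. Math. Phys. 80 (1981) 59–98 — the statement.
* [DaviesSimon1984] E. B. Davies, B. Simon, J. Funct. Anal. 59 (1984) 335–395, Lemma 6.2, (6.4) and Remark
  (`V ≤ C₁|x|^a + C₂ ⇒ −log ψ₀ ≤ C|x|^{a/2+1}`).
* [LopezGomez2012] J. López-Gómez, *Linear Second Order Elliptic Operators* (2012), Thm. 1.7 — the comparison.
* [Agmon1982] S. Agmon, *Lectures on Exponential Decay*, §1 — the bracket weights.
-/

noncomputable section

open Filter Set Metric
open scoped BigOperators Topology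

namespace Literature.Analysis.OperatorTheory.YMMatrixModel

/-! ### 1. Inputs from the tree

`luscherPotential_le_norm_pow_four : V x ≤ ¼‖x‖⁴`, `pderiv_coord_self`, `differentiable_coord`
(`YangMillsMatrixModelComparisonCalculus.lean`, seat infvol-p2); the bracket calculus `pderiv_bracket`,
`pderiv_profile`, `pderiv_weight`, `contDiff_weight` (`YangMillsMatrixModelAgmonWeights.lean`); the comparison
principle `le_of_strict_subsolution` (`YangMillsMatrixModelGroundStateComparison.lean`). -/

/-! ### 2. The cubic bracket profile `h_a(x) = −a⟨x⟩³` and the weight `W_a = exp h_a` -/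

/-- `∂_p (c g) = c ∂_p g` (the tree's `pderiv_smul` in `fun`-form). [folklore] -/
private theorem pderiv_const_mul' {g : ZM → ℝ} (hg : Differentiable ℝ g) (c : ℝ) (p : Fin 3 × Fin 3)
    (x : ZM) : pderiv p (fun y => c * g y) x = c * pderiv p g x :=
  pderiv_smul hg c p x

/-- The cubic profile `t ↦ −a t³` is smooth. [cite: Agmon1982, §1] -/
theorem contDiff_cubic (a : ℝ) {n : WithTop ℕ∞} : ContDiff ℝ n fun t : ℝ => -(a * t ^ 3) :=
  (contDiff_const.mul (contDiff_id.pow 3)).neg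

/-- `(−a t³)' = −3a t²`. [cite: Agmon1982, §1] -/
theorem deriv_cubic (a t : ℝ) : deriv (fun t : ℝ => -(a * t ^ 3)) t = -(3 * a * t ^ 2) := by
  have h := ((hasDerivAt_pow 3 t).const_mul a).neg
  rw [show (fun t : ℝ => -(a * t ^ 3)) = -fun y : ℝ => a * y ^ 3 from rfl, h.deriv]
  norm_num
  ring

/-- **First derivative of the cubic bracket profile**: `∂_p(−a⟨x⟩³) = −3a·⟨x⟩·x_p`
(`∂_p⟨x⟩ = x_p/⟨x⟩`). [cite: Agmon1982, §1 (1.10)] -/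
theorem pderiv_cubicProfile (a : ℝ) (p : Fin 3 × Fin 3) (x : ZM) :
    pderiv p (fun y : ZM => -(a * Real.sqrt (1 + ‖y‖ ^ 2) ^ 3)) x =
      -(3 * a) * (Real.sqrt (1 + ‖x‖ ^ 2) * x p) := by
  have e : (fun y : ZM => -(a * Real.sqrt (1 + ‖y‖ ^ 2) ^ 3)) =
      fun y => (fun t : ℝ => -(a * t ^ 3)) (Real.sqrt (1 + ‖y‖ ^ 2)) := rfl
  rw [e, pderiv_profile (contDiff_cubic a), pderiv_bracket, deriv_cubic]
  have ht : Real.sqrt (1 + ‖x‖ ^ 2) ≠ 0 := (bracket_pos x).ne'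
  rw [mul_div_assoc', div_eq_iff ht]
  ring

/-- **Second derivative of the cubic bracket profile**: `∂_p∂_p(−a⟨x⟩³) = −3a (x_p²/⟨x⟩ + ⟨x⟩)`.
[cite: Agmon1982, §1 (1.10)] -/
theorem pderiv_pderiv_cubicProfile (a : ℝ) (p : Fin 3 × Fin 3) (x : ZM) :
    pderiv p (pderiv p (fun y : ZM => -(a * Real.sqrt (1 + ‖y‖ ^ 2) ^ 3))) x =
      -(3 * a) * (x p ^ 2 / Real.sqrt (1 + ‖x‖ ^ 2) + Real.sqrt (1 + ‖x‖ ^ 2)) := by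
  have e1 : pderiv p (fun y : ZM => -(a * Real.sqrt (1 + ‖y‖ ^ 2) ^ 3)) =
      fun y => -(3 * a) * (Real.sqrt (1 + ‖y‖ ^ 2) * y p) := funext (pderiv_cubicProfile a p)
  have hbr : Differentiable ℝ fun y : ZM => Real.sqrt (1 + ‖y‖ ^ 2) :=
    (contDiff_bracket (n := 1)).differentiable one_ne_zero
  have hco : Differentiable ℝ fun y : ZM => y p := differentiable_coord p
  have e2 : (fun y : ZM => Real.sqrt (1 + ‖y‖ ^ 2) * y p) =
      (fun y : ZM => Real.sqrt (1 + ‖y‖ ^ 2)) * fun y : ZM => y p := rfl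
  have hprod : Differentiable ℝ fun y : ZM => Real.sqrt (1 + ‖y‖ ^ 2) * y p := hbr.mul hco
  rw [e1, pderiv_const_mul' hprod, e2, pderiv_mul hbr hco, pderiv_bracket, pderiv_coord_self]
  have ht : 0 < Real.sqrt (1 + ‖x‖ ^ 2) := bracket_pos x
  field_simp

/-- **Laplacian of the cubic bracket profile**: `Δ(−a⟨x⟩³) = −3a (‖x‖²/⟨x⟩ + 9⟨x⟩)`
(`= −30a⟨x⟩ + 3a/⟨x⟩`). [cite: Agmon1982, §1 (1.10)] -/
theorem laplacian_cubicProfile (a : ℝ) (x : ZM) :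
    laplacian (fun y : ZM => -(a * Real.sqrt (1 + ‖y‖ ^ 2) ^ 3)) x =
      -(3 * a) * (‖x‖ ^ 2 / Real.sqrt (1 + ‖x‖ ^ 2) + 9 * Real.sqrt (1 + ‖x‖ ^ 2)) := by
  rw [laplacian_def]
  simp only [pderiv_pderiv_cubicProfile]
  rw [← Finset.mul_sum, Finset.sum_add_distrib, ← Finset.sum_div, Finset.sum_const, Finset.card_univ,
    ← EuclideanSpace.real_norm_sq_eq]
  simp only [Fintype.card_prod, Fintype.card_fin, nsmul_eq_mul]
  norm_num

/-- **First derivative of the cubic weight**: `∂_p e^{−a⟨x⟩³} = e^{−a⟨x⟩³} · (−3a⟨x⟩x_p)`.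
[cite: Agmon1982, §1 (1.10)] -/
theorem pderiv_cubicWeight (a : ℝ) (p : Fin 3 × Fin 3) (x : ZM) :
    pderiv p (fun y : ZM => Real.exp (-(a * Real.sqrt (1 + ‖y‖ ^ 2) ^ 3))) x =
      Real.exp (-(a * Real.sqrt (1 + ‖x‖ ^ 2) ^ 3)) * (-(3 * a) * (Real.sqrt (1 + ‖x‖ ^ 2) * x p)) := by
  have e : (fun y : ZM => Real.exp (-(a * Real.sqrt (1 + ‖y‖ ^ 2) ^ 3))) =
      fun y => Real.exp ((fun t : ℝ => -(a * t ^ 3)) (Real.sqrt (1 + ‖y‖ ^ 2))) := rfl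
  rw [e, pderiv_weight (contDiff_cubic a), ← pderiv_cubicProfile a p x]

/-- The cubic weight is `C²`. [cite: Agmon1982, §1] -/
theorem contDiff_cubicWeight (a : ℝ) :
    ContDiff ℝ 2 fun y : ZM => Real.exp (-(a * Real.sqrt (1 + ‖y‖ ^ 2) ^ 3)) :=
  contDiff_weight (contDiff_cubic a)

/-- **Laplacian of the cubic weight**: with `t = ⟨x⟩`,
`Δ e^{−a t³} = e^{−a t³} · (9a² t² ‖x‖² − 3a(‖x‖²/t + 9t))` (`= |∇h|² + Δh` times the weight).
[cite: Agmon1982, §1 (1.10)] -/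
theorem laplacian_cubicWeight (a : ℝ) (x : ZM) :
    laplacian (fun y : ZM => Real.exp (-(a * Real.sqrt (1 + ‖y‖ ^ 2) ^ 3))) x =
      Real.exp (-(a * Real.sqrt (1 + ‖x‖ ^ 2) ^ 3)) *
        (9 * a ^ 2 * Real.sqrt (1 + ‖x‖ ^ 2) ^ 2 * ‖x‖ ^ 2 -
          3 * a * (‖x‖ ^ 2 / Real.sqrt (1 + ‖x‖ ^ 2) + 9 * Real.sqrt (1 + ‖x‖ ^ 2))) := by
  set W : ZM → ℝ := fun y => Real.exp (-(a * Real.sqrt (1 + ‖y‖ ^ 2) ^ 3)) with hW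
  set H : ZM → ℝ := fun y => -(a * Real.sqrt (1 + ‖y‖ ^ 2) ^ 3) with hH
  have hWd : Differentiable ℝ W := (contDiff_cubicWeight a).differentiable (by norm_num)
  have hH2 : ContDiff ℝ 2 H := contDiff_profile (contDiff_cubic a)
  have eW : ∀ p, pderiv p W = W * pderiv p H := fun p => by
    funext y
    rw [Pi.mul_apply, hW, pderiv_cubicWeight, hH, pderiv_cubicProfile]
  have e2 : ∀ p, pderiv p (pderiv p W) x =
      W x * (9 * a ^ 2 * Real.sqrt (1 + ‖x‖ ^ 2) ^ 2 * x p ^ 2) + W x * pderiv p (pderiv p H) x := by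
    intro p
    rw [eW p, pderiv_mul hWd (differentiable_pderiv_of_contDiff_two hH2 p), eW p, Pi.mul_apply, hH,
      pderiv_cubicProfile]
    ring
  rw [laplacian_def]
  simp only [e2]
  rw [Finset.sum_add_distrib, ← Finset.mul_sum, ← Finset.mul_sum, ← Finset.mul_sum,
    ← EuclideanSpace.real_norm_sq_eq, ← laplacian_def, hH, laplacian_cubicProfile]
  ring

/-- **`𝔥` on the cubic weight**: with `t = ⟨x⟩`,
`𝔥 e^{−a t³} = e^{−a t³} · (−(9/2)a² t² ‖x‖² + (3/2)a(‖x‖²/t + 9t) + V(x))`. [cite: Agmon1982, §1 (1.10)] -/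
theorem hApply_cubicWeight (a : ℝ) (x : ZM) :
    hApply (fun y : ZM => Real.exp (-(a * Real.sqrt (1 + ‖y‖ ^ 2) ^ 3))) x =
      Real.exp (-(a * Real.sqrt (1 + ‖x‖ ^ 2) ^ 3)) *
        (-(9 / 2 : ℝ) * a ^ 2 * Real.sqrt (1 + ‖x‖ ^ 2) ^ 2 * ‖x‖ ^ 2 +
          (3 / 2 : ℝ) * a * (‖x‖ ^ 2 / Real.sqrt (1 + ‖x‖ ^ 2) + 9 * Real.sqrt (1 + ‖x‖ ^ 2)) +
            luscherPotential x) := by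
  rw [hApply_def, laplacian_cubicWeight]
  ring

/-! ### 3. The weight is a strict subsolution outside a ball -/

/-- ★ **Strict subsolution far out.**  Let `a > 0` with `18a² > 1` (i.e. `a > 1/√18`, the generic Agmon
rate of `V ≤ ¼‖x‖⁴`).  Then there is `t₀ ≥ 1` such that on `⟨x⟩ ≥ t₀`
`𝔥W_a(x) + (|E| − E + 1)·W_a(x) ≤ 0`, `W_a = e^{−a⟨x⟩³}`: the leading term `−((9/2)a² − ¼)⟨x⟩⁴` of
`𝔥W_a/W_a` beats `(9/2)a²⟨x⟩² + 15a⟨x⟩ + 2|E| + 1`. [cite: CarmonaSimon1981, Thm. (lower bound)] -/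
theorem hApply_cubicWeight_neg {a : ℝ} (ha : 0 < a) (ha' : 1 < 18 * a ^ 2) (E : ℝ) :
    ∃ t₀ : ℝ, 1 ≤ t₀ ∧ ∀ x : ZM, t₀ ≤ Real.sqrt (1 + ‖x‖ ^ 2) →
      hApply (fun y : ZM => Real.exp (-(a * Real.sqrt (1 + ‖y‖ ^ 2) ^ 3))) x +
          (|E| - E + 1) * Real.exp (-(a * Real.sqrt (1 + ‖x‖ ^ 2) ^ 3)) ≤ 0 := by
  obtain ⟨δ, hδdef⟩ : ∃ δ : ℝ, δ = 9 / 2 * a ^ 2 - 1 / 4 := ⟨_, rfl⟩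
  obtain ⟨M, hMdef⟩ : ∃ M : ℝ, M = 9 / 2 * a ^ 2 + 15 * a + 2 * |E| + 2 := ⟨_, rfl⟩
  have hδ : 0 < δ := by rw [hδdef]; nlinarith
  have hE0 : 0 ≤ |E| := abs_nonneg E
  have hδM : δ ≤ M := by rw [hδdef, hMdef]; nlinarith
  have hMδ0 : 0 ≤ M / δ := div_nonneg (hδ.le.trans hδM) hδ.le
  refine ⟨Real.sqrt (M / δ), ?_, fun x hx => ?_⟩
  · rw [Real.le_sqrt (by norm_num) hMδ0, one_pow, le_div_iff₀ hδ]
    linarith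
  · set t : ℝ := Real.sqrt (1 + ‖x‖ ^ 2) with htdef
    have ht1 : 1 ≤ t := one_le_bracket x
    have ht0 : 0 < t := bracket_pos x
    have hts : t ^ 2 = 1 + ‖x‖ ^ 2 := bracket_sq x
    have hMt : M ≤ δ * t ^ 2 := by
      have h1 : M / δ ≤ t ^ 2 := by
        have h := pow_le_pow_left₀ (Real.sqrt_nonneg _) hx 2
        rwa [Real.sq_sqrt hMδ0] at h
      rwa [div_le_iff₀ hδ, mul_comm] at h1
    rw [hApply_cubicWeight]
    have hW : 0 < Real.exp (-(a * t ^ 3)) := Real.exp_pos _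
    have hs : ‖x‖ ^ 2 = t ^ 2 - 1 := by linarith
    have hdiv : ‖x‖ ^ 2 / t ≤ t := by
      rw [div_le_iff₀ ht0, hs]; nlinarith
    have htt : t ≤ t ^ 2 := by nlinarith
    have h1 : (3 / 2 : ℝ) * a * (‖x‖ ^ 2 / t + 9 * t) ≤ 15 * a * t ^ 2 := by
      have h1a : (3 / 2 : ℝ) * a * (‖x‖ ^ 2 / t + 9 * t) ≤ (3 / 2 : ℝ) * a * (t + 9 * t) :=
        mul_le_mul_of_nonneg_left (add_le_add hdiv le_rfl) (by positivity)
      nlinarith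
    have h2 : luscherPotential x ≤ (1 / 4 : ℝ) * t ^ 4 := by
      have hV := luscherPotential_le_norm_pow_four x
      have h4 : ‖x‖ ^ 4 = (t ^ 2 - 1) ^ 2 := by
        rw [show ‖x‖ ^ 4 = (‖x‖ ^ 2) ^ 2 by ring, hs]
      rw [h4] at hV
      nlinarith
    have hE : -E ≤ |E| := neg_le_abs E
    have h3 : M * t ^ 2 ≤ δ * t ^ 2 * t ^ 2 := mul_le_mul_of_nonneg_right hMt (sq_nonneg t)
    have h5 : (2 * |E| + 1) * 1 ≤ (2 * |E| + 1) * t ^ 2 :=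
      mul_le_mul_of_nonneg_left (by nlinarith) (by positivity)
    have key : -(9 / 2 : ℝ) * a ^ 2 * t ^ 2 * ‖x‖ ^ 2 +
        (3 / 2 : ℝ) * a * (‖x‖ ^ 2 / t + 9 * t) + luscherPotential x + (|E| - E + 1) ≤ 0 := by
      rw [hs] at h1 ⊢
      have h6 : -(9 / 2 : ℝ) * a ^ 2 * t ^ 2 * (t ^ 2 - 1) = -(δ + 1 / 4) * (t ^ 2 * t ^ 2) +
          9 / 2 * a ^ 2 * t ^ 2 := by rw [hδdef]; ring
      rw [h6]
      have h7 : t ^ 4 = t ^ 2 * t ^ 2 := by ring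
      rw [h7] at h2
      rw [hMdef] at h3
      nlinarith
    have : Real.exp (-(a * t ^ 3)) *
        (-(9 / 2 : ℝ) * a ^ 2 * t ^ 2 * ‖x‖ ^ 2 + (3 / 2 : ℝ) * a * (‖x‖ ^ 2 / t + 9 * t) +
          luscherPotential x) + (|E| - E + 1) * Real.exp (-(a * t ^ 3)) =
        Real.exp (-(a * t ^ 3)) *
          (-(9 / 2 : ℝ) * a ^ 2 * t ^ 2 * ‖x‖ ^ 2 + (3 / 2 : ℝ) * a * (‖x‖ ^ 2 / t + 9 * t) +
            luscherPotential x + (|E| - E + 1)) := by ring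
    rw [this]
    exact mul_nonpos_of_nonneg_of_nonpos hW.le key

/-- `𝔥` on `m·(W − κ)` for a constant `κ`: `𝔥(m(W − κ)) = m(𝔥W − V·κ)` (the Laplacian kills constants).
[cite: LopezGomez2012, Thm. 1.7] -/
theorem hApply_const_mul_sub_const {W : ZM → ℝ} (hW : ContDiff ℝ 2 W) (m κ : ℝ) (x : ZM) :
    hApply (fun y => m * (W y - κ)) x = m * (hApply W x - luscherPotential x * κ) := by
  have hWd : Differentiable ℝ W := hW.differentiable (by norm_num)
  have e1 : ∀ p, pderiv p (fun y => m * (W y - κ)) = fun y => m * pderiv p W y := by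
    intro p
    funext y
    rw [pderiv_const_mul' (hWd.sub_const κ)]
    congr 1
    simp only [pderiv, fderiv_sub_const]
  have e2 : ∀ p, pderiv p (pderiv p (fun y => m * (W y - κ))) x = m * pderiv p (pderiv p W) x := by
    intro p
    rw [e1 p, pderiv_const_mul' (differentiable_pderiv_of_contDiff_two hW p)]
  rw [hApply_def, hApply_def, laplacian_def, laplacian_def]
  simp only [e2, ← Finset.mul_sum]
  ring

/-! ### 4. The lower bound -/

/-- ★★ **Carmona–Simon lower bound for positive solutions of `𝔥f = Ef` on `ℝ⁹`, explicit rate.**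
If `f ∈ C²(ℝ⁹)`, `f > 0` everywhere and `𝔥f = Ef` pointwise, then for every `a > 0` with `18a² > 1`
there is `c > 0` with `f(y) ≥ c·exp(−a(1+‖y‖)³)` for all `y`.  Proof: comparison
(`le_of_strict_subsolution`) of `f` with `m(e^{−a⟨x⟩³} − e^{−aT³})` on the annuli `t₀ ≤ ⟨x⟩ ≤ T`,
`m e^{−at₀³} = min_{⟨x⟩≤t₀} f`, and `⟨y⟩ ≤ 1 + ‖y‖`. [cite: CarmonaSimon1981, Thm. (lower bound)] -/
theorem groundState_lower_bound_cubic {f : ZM → ℝ} {E : ℝ} (hf : ContDiff ℝ 2 f) (hpos : ∀ x, 0 < f x)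
    (heq : ∀ x, hApply f x = E * f x) {a : ℝ} (ha : 0 < a) (ha' : 1 < 18 * a ^ 2) :
    ∃ c : ℝ, 0 < c ∧ ∀ y : ZM, c * Real.exp (-(a * (1 + ‖y‖) ^ 3)) ≤ f y := by
  obtain ⟨t₀, ht₀1, hneg⟩ := hApply_cubicWeight_neg ha ha' E
  have hbrc : Continuous fun y : ZM => Real.sqrt (1 + ‖y‖ ^ 2) := (contDiff_bracket (n := 0)).continuous
  -- the inner ball `⟨x⟩ ≤ t₀` and the minimum `μ` of `f` there
  set B₀ : Set ZM := {x | Real.sqrt (1 + ‖x‖ ^ 2) ≤ t₀} with hB₀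
  have hB₀c : IsCompact B₀ := by
    refine (isCompact_closedBall (0 : ZM) t₀).of_isClosed_subset (isClosed_le hbrc continuous_const) ?_
    intro x hx
    rw [mem_closedBall_zero_iff]
    exact (norm_le_bracket x).trans hx
  have h0 : (0 : ZM) ∈ B₀ := by
    show Real.sqrt (1 + ‖(0 : ZM)‖ ^ 2) ≤ t₀
    simpa using ht₀1
  obtain ⟨xm, hxmB, hmin⟩ := hB₀c.exists_isMinOn ⟨0, h0⟩ hf.continuous.continuousOn
  set μ : ℝ := f xm with hμ
  have hμ0 : 0 < μ := hpos xm
  refine ⟨μ / 2, by positivity, fun y => ?_⟩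
  have hey : Real.exp (-(a * (1 + ‖y‖) ^ 3)) ≤ Real.exp (-(a * Real.sqrt (1 + ‖y‖ ^ 2) ^ 3)) := by
    rw [Real.exp_le_exp, neg_le_neg_iff]
    exact mul_le_mul_of_nonneg_left
      (pow_le_pow_left₀ (Real.sqrt_nonneg _) (bracket_le_one_add_norm y) 3) ha.le
  have hey1 : Real.exp (-(a * (1 + ‖y‖) ^ 3)) ≤ 1 := by
    rw [Real.exp_le_one_iff, neg_nonpos]; positivity
  by_cases hy : Real.sqrt (1 + ‖y‖ ^ 2) ≤ t₀
  · -- inside the ball: `f y ≥ μ ≥ μ/2 ≥ (μ/2)·e^{…}`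
    have h1 : μ ≤ f y := hmin hy
    nlinarith
  · -- outside: comparison on the annulus `t₀ ≤ ⟨x⟩ ≤ T`
    have hty : t₀ < Real.sqrt (1 + ‖y‖ ^ 2) := not_le.1 hy
    set T : ℝ := Real.sqrt (1 + ‖y‖ ^ 2) + (1 / a + 1) with hT
    have haT : 0 < 1 / a + 1 := by positivity
    set κ : ℝ := Real.exp (-(a * T ^ 3)) with hκ
    set m : ℝ := μ * Real.exp (a * t₀ ^ 3) with hm
    have hm0 : 0 < m := by positivity
    set W : ZM → ℝ := fun x => Real.exp (-(a * Real.sqrt (1 + ‖x‖ ^ 2) ^ 3)) with hWdef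
    have hW2 : ContDiff ℝ 2 W := contDiff_cubicWeight a
    set w : ZM → ℝ := fun x => m * (W x - κ) with hwdef
    have hw2 : ContDiff ℝ 2 w := contDiff_const.mul (hW2.sub contDiff_const)
    set K : Set ZM := {x | t₀ ≤ Real.sqrt (1 + ‖x‖ ^ 2) ∧ Real.sqrt (1 + ‖x‖ ^ 2) ≤ T} with hK
    set Ω : Set ZM := {x | t₀ < Real.sqrt (1 + ‖x‖ ^ 2) ∧ Real.sqrt (1 + ‖x‖ ^ 2) < T} with hΩ
    have hKc : IsCompact K := by
      refine (isCompact_closedBall (0 : ZM) T).of_isClosed_subset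
        ((isClosed_le continuous_const hbrc).inter (isClosed_le hbrc continuous_const)) ?_
      intro x hx
      rw [mem_closedBall_zero_iff]
      exact (norm_le_bracket x).trans hx.2
    have hΩo : IsOpen Ω := (isOpen_lt continuous_const hbrc).inter (isOpen_lt hbrc continuous_const)
    have hΩK : Ω ⊆ K := fun x hx => ⟨hx.1.le, hx.2.le⟩
    -- monotonicity of the weight in the bracket
    have hWmono : ∀ {s s' : ℝ}, s ≤ s' → 0 ≤ s → Real.exp (-(a * s' ^ 3)) ≤ Real.exp (-(a * s ^ 3)) :=
      fun {s s'} h hs => by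
        rw [Real.exp_le_exp, neg_le_neg_iff]
        exact mul_le_mul_of_nonneg_left (pow_le_pow_left₀ hs h 3) ha.le
    -- strict subsolution on `Ω`
    have hsub : ∀ x ∈ Ω, hApply w x < E * w x := by
      intro x hx
      have hxt : 0 < Real.sqrt (1 + ‖x‖ ^ 2) := bracket_pos x
      have hWx : 0 < W x := Real.exp_pos _
      have hκW : κ ≤ W x := hWmono hx.2.le hxt.le
      have hκ0 : 0 < κ := Real.exp_pos _
      have hV0 : 0 ≤ luscherPotential x := luscherPotential_nonneg x
      have hn := hneg x hx.1.le
      have hE : E * κ ≤ |E| * W x :=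
        (mul_le_mul_of_nonneg_right (le_abs_self E) hκ0.le).trans
          (mul_le_mul_of_nonneg_left hκW (abs_nonneg E))
      rw [hwdef, hApply_const_mul_sub_const hW2]
      have hVκ : 0 ≤ luscherPotential x * κ := mul_nonneg hV0 hκ0.le
      have hlt : hApply W x - luscherPotential x * κ < E * (W x - κ) := by nlinarith
      show m * (hApply W x - luscherPotential x * κ) < E * (m * (W x - κ))
      calc m * (hApply W x - luscherPotential x * κ)
          < m * (E * (W x - κ)) := mul_lt_mul_of_pos_left hlt hm0
        _ = E * (m * (W x - κ)) := by ring
    -- boundary values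
    have hbdry : ∀ x ∈ K, x ∉ Ω → w x ≤ f x := by
      intro x hxK hxΩ
      have hcases : Real.sqrt (1 + ‖x‖ ^ 2) ≤ t₀ ∨ T ≤ Real.sqrt (1 + ‖x‖ ^ 2) := by
        by_cases h1 : Real.sqrt (1 + ‖x‖ ^ 2) ≤ t₀
        · exact Or.inl h1
        · exact Or.inr (not_lt.1 fun h2 => hxΩ ⟨not_le.1 h1, h2⟩)
      rcases hcases with h | h
      · -- inner sphere: `⟨x⟩ = t₀`, `w x ≤ m e^{−a t₀³} = μ ≤ f x`
        have heqt : Real.sqrt (1 + ‖x‖ ^ 2) = t₀ := le_antisymm h hxK.1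
        have hfx : μ ≤ f x := hmin h
        have hWx : W x = Real.exp (-(a * t₀ ^ 3)) := by rw [hWdef]; simp only [heqt]
        have hmW : m * Real.exp (-(a * t₀ ^ 3)) = μ := by
          rw [hm, mul_assoc, ← Real.exp_add, add_neg_cancel, Real.exp_zero, mul_one]
        have hκ0 : 0 ≤ κ := (Real.exp_pos _).le
        calc w x = m * (W x - κ) := rfl
          _ ≤ m * W x := by nlinarith
          _ = μ := by rw [hWx, hmW]
          _ ≤ f x := hfx
      · -- outer sphere: `⟨x⟩ = T`, `w x = 0 < f x`
        have heqt : Real.sqrt (1 + ‖x‖ ^ 2) = T := le_antisymm hxK.2 h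
        have hWx : W x = κ := by rw [hWdef, hκ]; simp only [heqt]
        calc w x = m * (W x - κ) := rfl
          _ = 0 := by rw [hWx, sub_self, mul_zero]
          _ ≤ f x := (hpos x).le
    -- comparison at `y`
    have hyK : y ∈ K := ⟨hty.le, by rw [hT]; linarith⟩
    have hcomp := le_of_strict_subsolution hKc hΩo hΩK hf hw2 hpos heq hsub hbdry y hyK
    -- `w y ≥ (m/2) W y ≥ (μ/2) e^{−a(1+‖y‖)³}`
    have hty0 : 0 < Real.sqrt (1 + ‖y‖ ^ 2) := bracket_pos y
    have hty1 : 1 ≤ Real.sqrt (1 + ‖y‖ ^ 2) := one_le_bracket y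
    have hgap : 1 ≤ a * (T ^ 3 - Real.sqrt (1 + ‖y‖ ^ 2) ^ 3) := by
      have hTt : T - Real.sqrt (1 + ‖y‖ ^ 2) = 1 / a + 1 := by rw [hT]; ring
      have hcube : T - Real.sqrt (1 + ‖y‖ ^ 2) ≤ T ^ 3 - Real.sqrt (1 + ‖y‖ ^ 2) ^ 3 := by
        have hTge : Real.sqrt (1 + ‖y‖ ^ 2) ≤ T := by rw [hT]; linarith
        nlinarith [mul_nonneg (sub_nonneg.2 hTge) (by nlinarith : (0 : ℝ) ≤ T ^ 2 +
          T * Real.sqrt (1 + ‖y‖ ^ 2) + Real.sqrt (1 + ‖y‖ ^ 2) ^ 2 - 1)]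
      have h1 : 1 ≤ a * (T - Real.sqrt (1 + ‖y‖ ^ 2)) := by
        rw [hTt]; field_simp; linarith
      exact h1.trans (mul_le_mul_of_nonneg_left hcube ha.le)
    have hκhalf : 2 * κ ≤ W y := by
      -- `κ = W y · e^{−a(T³ − t³)}` and `e^{a(T³−t³)} ≥ 1 + a(T³−t³) ≥ 2`
      have hsplit : W y = κ * Real.exp (a * (T ^ 3 - Real.sqrt (1 + ‖y‖ ^ 2) ^ 3)) := by
        rw [hκ, ← Real.exp_add]
        show Real.exp (-(a * Real.sqrt (1 + ‖y‖ ^ 2) ^ 3)) = _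
        congr 1
        ring
      have h2 : (2 : ℝ) ≤ Real.exp (a * (T ^ 3 - Real.sqrt (1 + ‖y‖ ^ 2) ^ 3)) := by
        have := Real.add_one_le_exp (a * (T ^ 3 - Real.sqrt (1 + ‖y‖ ^ 2) ^ 3))
        linarith
      rw [hsplit]
      have hκ0 : 0 ≤ κ := (Real.exp_pos _).le
      nlinarith
    have hexp0 : 1 ≤ Real.exp (a * t₀ ^ 3) := Real.one_le_exp (by positivity)
    have hWy : W y = Real.exp (-(a * Real.sqrt (1 + ‖y‖ ^ 2) ^ 3)) := rfl
    have hwy : w y = m * (W y - κ) := rfl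
    rw [hwy] at hcomp
    rw [← hWy] at hey
    have hWy0 : 0 ≤ W y := (Real.exp_pos _).le
    calc μ / 2 * Real.exp (-(a * (1 + ‖y‖) ^ 3)) ≤ μ / 2 * W y :=
          mul_le_mul_of_nonneg_left hey (by positivity)
      _ ≤ m / 2 * W y := by
          apply mul_le_mul_of_nonneg_right _ hWy0
          rw [hm]
          nlinarith
      _ ≤ m * (W y - κ) := by nlinarith
      _ ≤ f y := hcomp

/-- ★ **Carmona–Simon lower bound** (existential form, the shape consumed downstream): a positive `C²`
solution of `𝔥f = Ef` on `ℝ⁹` satisfies `f(y) ≥ c·e^{−a(1+‖y‖)³}` for some `c, a > 0`.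
[cite: CarmonaSimon1981, Thm. (lower bound)] -/
theorem groundState_lower_bound_cubic' {f : ZM → ℝ} {E : ℝ} (hf : ContDiff ℝ 2 f) (hpos : ∀ x, 0 < f x)
    (heq : ∀ x, hApply f x = E * f x) :
    ∃ c a : ℝ, 0 < c ∧ 0 < a ∧ ∀ y : ZM, c * Real.exp (-(a * (1 + ‖y‖) ^ 3)) ≤ f y := by
  obtain ⟨c, hc, h⟩ := groundState_lower_bound_cubic hf hpos heq (a := 1) one_pos (by norm_num)
  exact ⟨c, 1, hc, one_pos, h⟩

end Literature.Analysis.OperatorTheory.YMMatrixModel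

end
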